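import Mathlib
import HarnessLib

/-!
# ValiantsHypothesis — ArithmeticDescent II (prime notch): CALIBRATION of the two residual shapes
# (kernel, route-independent)

Decomposition workshop `decomp-valiant`, lens 2, generation 13.  The prime-notch split of the residual
`Descent` (`Theorems/ArithmeticDescentPrimes.lean`) has two factors of the shapes

* INERTIA shape (`InertiaPiece ⟺ (PrimesIO → PrimesAE)`): "holds modulo infinitely many primes ⟹ holds
  modulo almost all primes";
* HASSE shape (`HassePiece`, contrapositive): "holds modulo (almost) all primes ⟹ holds over `ℚ`";

for the arithmetic statement "the circuit-existence system for `per_n` at size `n^c` has a point".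
This file certifies, sorry-free, that NEITHER shape is a general principle of arithmetic — both fail
already for points of zero-dimensional systems `y² = a` — so any proof of `InertiaPiece` / `HassePiece`
must use structure specific to circuit-existence varieties of the permanent (negative calibration, in
the sense of the workshop's T4-cal): `two_isSquare_io` / `two_not_isSquare_io` (Dirichlet + second
supplement: `2` is a square modulo infinitely many primes and a non-square modulo infinitely many),
`inertiaShape_fails`; `isSquare_two_three_six` (for every prime one of `2, 3, 6` is a square mod `p`),
`not_isSquare_two_three_six_rat`, `hasseShape_fails`. [folklore; Mathlib `Nat.forall_exists_prime_gt_and_eq_mod`,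
`ZMod.exists_sq_eq_two_iff`, `quadraticChar`]
-/

set_option linter.dupNamespace false

namespace Summit.ValiantsHypothesis.ValiantsHypothesis.Theorems.ArithmeticDescent

/-- Dirichlet for the residue class `a mod 8`, in the `p₀ ≤ p` form used by the prime notches. -/
theorem exists_prime_ge_mod_eight (a : ℕ) (ha : a.Coprime 8) (p₀ : ℕ) :
    ∃ p, p₀ ≤ p ∧ p.Prime ∧ p % 8 = a % 8 := by
  have hu : IsUnit ((a : ℕ) : ZMod 8) := by
    rw [← ZMod.coe_unitOfCoprime a ha]; exact Units.isUnit _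
  obtain ⟨p, hp, hprime, hpa⟩ := Nat.forall_exists_prime_gt_and_eq_mod hu p₀
  exact ⟨p, hp.le, hprime, (ZMod.natCast_eq_natCast_iff' p a 8).mp hpa⟩

/-- `2` is a square modulo infinitely many primes (the primes `≡ 1 mod 8` suffice). [folklore] -/
theorem two_isSquare_io : ∀ p₀ : ℕ, ∃ p, p₀ ≤ p ∧ p.Prime ∧ IsSquare (2 : ZMod p) := by
  intro p₀
  obtain ⟨p, hp, hprime, hmod⟩ := exists_prime_ge_mod_eight 1 (by decide) p₀
  haveI := Fact.mk hprime
  have hp2 : p ≠ 2 := by omega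
  exact ⟨p, hp, hprime, (ZMod.exists_sq_eq_two_iff (p := p) hp2).mpr (Or.inl (by omega))⟩

/-- `2` is a non-square modulo infinitely many primes (the primes `≡ 3 mod 8`). [folklore] -/
theorem two_not_isSquare_io : ∀ p₀ : ℕ, ∃ p, p₀ ≤ p ∧ p.Prime ∧ ¬ IsSquare (2 : ZMod p) := by
  intro p₀
  obtain ⟨p, hp, hprime, hmod⟩ := exists_prime_ge_mod_eight 3 (by decide) p₀
  haveI := Fact.mk hprime
  have hp2 : p ≠ 2 := by omega
  refine ⟨p, hp, hprime, fun h => ?_⟩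
  have := (ZMod.exists_sq_eq_two_iff (p := p) hp2).mp h
  omega

/-- `2`, `3`, `6` are not perfect squares. [folklore] -/
theorem not_isSquare_nat_two_three_six :
    ¬ IsSquare (2 : ℕ) ∧ ¬ IsSquare (3 : ℕ) ∧ ¬ IsSquare (6 : ℕ) := by
  refine ⟨?_, ?_, ?_⟩ <;>
  · rintro ⟨r, hr⟩
    have : r ≤ 3 := by nlinarith
    interval_cases r <;> omega

/-- `2` is a square in `ℚ̄`. [folklore] -/
theorem isSquare_two_algClosure : IsSquare (2 : AlgebraicClosure ℚ) := by
  obtain ⟨z, hz⟩ := IsAlgClosed.exists_pow_nat_eq (2 : AlgebraicClosure ℚ) (n := 2) (by norm_num)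
  exact ⟨z, by rw [← hz, sq]⟩

/-- **The INERTIA shape is not a general principle.**  "`a` is a square modulo infinitely many primes ⟹
`a` is a square modulo almost all primes" fails at `a = 2` (although `2` is a square in `ℚ̄`, as every
integer is): the inert primes `p ≡ ±3 (mod 8)` are the obstruction.  Hence `InertiaPiece`
(`PrimesIO → PrimesAE` for the permanent) needs input specific to circuit-existence systems. [folklore] -/
theorem inertiaShape_fails :
    ¬ ∀ a : ℕ, IsSquare (a : AlgebraicClosure ℚ) →
        (∀ p₀ : ℕ, ∃ p, p₀ ≤ p ∧ p.Prime ∧ IsSquare (a : ZMod p)) →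
        ∃ p₀ : ℕ, ∀ p, p₀ ≤ p → p.Prime → IsSquare (a : ZMod p) := by
  intro h
  have h2 := h 2 (by exact_mod_cast isSquare_two_algClosure) (by exact_mod_cast two_isSquare_io)
  obtain ⟨p₀, hp₀⟩ := h2
  obtain ⟨p, hp, hprime, hns⟩ := two_not_isSquare_io p₀
  exact hns (by exact_mod_cast hp₀ p hp hprime)

/-- For EVERY prime `p`, one of `2, 3, 6` is a square modulo `p` (multiplicativity of the quadratic
character; `p = 2, 3` directly). [folklore] -/
theorem isSquare_two_three_six (p : ℕ) [hp : Fact p.Prime] :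
    IsSquare (2 : ZMod p) ∨ IsSquare (3 : ZMod p) ∨ IsSquare (6 : ZMod p) := by
  classical
  by_cases h2 : p = 2
  · refine Or.inl ⟨0, ?_⟩
    rw [mul_zero, show (2 : ZMod p) = ((2 : ℕ) : ZMod p) by norm_cast, ZMod.natCast_eq_zero_iff, h2]
  by_cases h3 : p = 3
  · refine Or.inr (Or.inl ⟨0, ?_⟩)
    rw [mul_zero, show (3 : ZMod p) = ((3 : ℕ) : ZMod p) by norm_cast, ZMod.natCast_eq_zero_iff, h3]
  by_contra hcon
  simp only [not_or] at hcon
  obtain ⟨hn2, hn3, hn6⟩ := hcon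
  have h6 : (6 : ZMod p) ≠ 0 := by
    intro h
    have h' : ((6 : ℕ) : ZMod p) = 0 := by exact_mod_cast h
    rw [ZMod.natCast_eq_zero_iff] at h'
    have h23 : p ∣ 2 * 3 := by simpa using h'
    rcases (Nat.Prime.dvd_mul hp.out).mp h23 with h | h
    · exact h2 ((Nat.prime_dvd_prime_iff_eq hp.out Nat.prime_two).mp h)
    · exact h3 ((Nat.prime_dvd_prime_iff_eq hp.out Nat.prime_three).mp h)
  have hq2 := (quadraticChar_neg_one_iff_not_isSquare (F := ZMod p)).mpr hn2
  have hq3 := (quadraticChar_neg_one_iff_not_isSquare (F := ZMod p)).mpr hn3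
  have hq6 : quadraticChar (ZMod p) 6 = 1 := by
    rw [show (6 : ZMod p) = 2 * 3 by norm_num, map_mul, hq2, hq3]; norm_num
  exact hn6 ((quadraticChar_one_iff_isSquare h6).mp hq6)

/-- None of `2, 3, 6` is a square in `ℚ`. [folklore] -/
theorem not_isSquare_two_three_six_rat :
    ¬ (IsSquare (2 : ℚ) ∨ IsSquare (3 : ℚ) ∨ IsSquare (6 : ℚ)) := by
  rw [Rat.isSquare_ofNat_iff, Rat.isSquare_ofNat_iff, Rat.isSquare_ofNat_iff]
  obtain ⟨h2, h3, h6⟩ := not_isSquare_nat_two_three_six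
  rintro (h | h | h) <;> contradiction

/-- **The HASSE shape is not a general principle.**  "solvable modulo every prime ⟹ solvable over `ℚ`"
fails for `(y² - 2)(y² - 3)(y² - 6)`: a root modulo every prime, no rational root.  Hence `HassePiece`
(`VP_ℚ ≠ VNP_ℚ → PrimesIO` for the permanent; contrapositive: `𝔽_p`-circuits at almost all primes ⟹ a
`ℚ`-circuit family) needs input specific to circuit-existence systems. [folklore] -/
theorem hasseShape_fails :
    ¬ ∀ a b c : ℕ,
        (∀ p : ℕ, p.Prime → IsSquare (a : ZMod p) ∨ IsSquare (b : ZMod p) ∨ IsSquare (c : ZMod p)) →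
        (IsSquare (a : ℚ) ∨ IsSquare (b : ℚ) ∨ IsSquare (c : ℚ)) := by
  intro h
  have h' := h 2 3 6 (fun p hp => by
    haveI := Fact.mk hp
    exact_mod_cast isSquare_two_three_six p)
  exact not_isSquare_two_three_six_rat (by exact_mod_cast h')

end Summit.ValiantsHypothesis.ValiantsHypothesis.Theorems.ArithmeticDescent
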